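import Literature.Analysis.FluidPDE.HardSpherePhaseSpace
import Literature.Analysis.FluidPDE.CollisionWeakForm
import HarnessLib

/-!
# The test-side (adjoint) Enskog collision operator for hard spheres of diameter `ε`

Topic `Literature/Analysis/FluidPDE`; namespace `Literature.Analysis.FluidPDE` (next to
`Geometry`, `HardSpherePhaseSpace.lean`, and the Boltzmann weak-form files `CollisionWeakForm.lean`).
Definition request `defn-enskogTestOperator` of route AtomisticToContinuum/EmpiricalEnskogDuality.
Everything stated here is PROVED; there is no named fact.

## The object

Enskog's collision operator for a dense gas of hard spheres of diameter `D` differs from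
Boltzmann's in two ways: the collision partner sits at the contact point `r ± D n̂` instead of at
`r`, and the product of one-particle densities is weighted by the pair correlation at contact `χ`
(Soto, *Kinetic Theory and Transport Phenomena*, §4.8.1, eq. (4.87):
`J_Enskog[f](c) = D² ∫ [χ(r − n/2) f(r, c′) f(r − n, c₁′) − χ(r + n/2) f(r, c) f(r + n, c₁)] (g·n̂) Θ(g·n̂) d²n̂ d³c₁`;
revised/modified Enskog theory: van Beijeren–Ernst 1973, Résibois 1978).  Testing such an operator
against a function `φ(x, v)` of ONE particle and symmetrising over the exchange of the two partners
(the computation behind Résibois' `H`-theorem, and the hard-sphere analogue of the Boltzmann weak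
form `CollisionWeakForm.lean`) produces, for a background density `g`, a rate `λ`, and a contact
weight `Y(x, ω)`, the linear operator on test functions

`(L φ)(x, v) = λ ∫_{S^{d-1}} ∫_{ℝ^d} ((v − w)·ω)₊ Y(x, ω) g(x + εω, w) ·`
`    [φ(x, v′) + φ(x + εω, w′) − φ(x, v) − φ(x + εω, w)] dw dσ(ω)`,

`(v′, w′) = collide ω (v, w)` — the partner is drawn from the background AT CONTACT DISTANCE `ε` in
the direction `ω`, and the bracket is the FULL increment of `φ` over the pair.  This is
`enskogTestOperator G ε λ Y g φ` below, on any position space `X` with a `Geometry d X`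
(translation `x + εω = G.translate x (ε • ω)`; in use: the torus `𝕋³`), with the bracket singled out
as `enskogPairIncrement`.  It is the first-order (Hájek/Hoeffding) kernel of the empirical collision
sum of an `N`-sphere system and the generator appearing in the weak Enskog equation; the identity
`∫∫ g · (L φ) = 2 ⟨λ Q^E(g, g), φ⟩` with the quadratic Enskog operator is a Fubini/involution
computation that is NOT carried out here.

## What is proved

* `enskogPairIncrement_eq_zero_of_isCollisionInvariant`, `enskogTestOperator_const_of_isCollisionInvariant`
  — a test function `φ(x, v) = ψ(v)` that does not depend on `x` and is a collision invariant
  (`IsCollisionInvariant ψ`: `1`, `v`, `|v|²`) is annihilated exactly (for `x`-dependent `φ` only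
  up to the `O(ε)` shift `x ↦ x + εω`, which is the collisional transfer).
* `enskogPairIncrement_exchange` — the increment is invariant under the pair exchange
  `(x, v, w, ω) ↦ (x + εω, w, v, −ω)` (tree lemmas `collide_neg_dir`, `collide_swap`, and the
  action axioms of `Geometry`).
* `enskogTestOperator_zero_rate`, `enskogTestOperator_mul_rate` — dependence on the rate.
* `enskogPairIncrement_inner_euclidean` — on `ℝ^d`, the increment of `φ(x, v) = ⟪x, v⟫` is the
  collisional transfer `ε (v − w)·ω` (so the objects are not trivially zero).

Measure conventions: `dσ = sphereMeasure` (Mathlib `Measure.toSphere` of Lebesgue measure, as in the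
tree's `collisionOp`), `dw` Lebesgue on `EuclideanSpace ℝ d`; the `ω`-integral is the OUTER one.
No integrability is assumed in the definition (Bochner integrals, junk value `0`).

## References

* R. Soto, *Kinetic Theory and Transport Phenomena*, OUP 2016, §4.8.1 eq. (4.87) (Enskog's
  collision operator, contact partner at `r ± n`, pair correlation at contact). [Soto2016]
* H. van Beijeren, M. H. Ernst, *The modified Enskog equation*, Physica 68 (1973) 437–456.
  [VanbeijerenErnst1973]
* P. Résibois, *H-theorem for the (modified) nonlinear Enskog equation*, J. Stat. Phys. 19 (1978)
  593–609 (symmetrised weak form). [Resibois1978]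
* L. Arkeryd, C. Cercignani, J. Stat. Phys. 59 (1990) 845–867 (the Enskog equation for diameter
  `σ`, factor `Y`). [ArkerydCercignani1990]
* T. Bodineau, I. Gallagher, L. Saint-Raymond, Ann. PDE 3 (2017) (adjoint linearised collision
  operators on test functions). [BGSR2017]
-/

noncomputable section

open MeasureTheory Metric
open scoped InnerProductSpace
open Literature.MathematicalPhysics.KineticTheory (collide hardSphereKernel sphereMeasure
  IsCollisionInvariant real_inner_self_sphere)

namespace Literature.Analysis.FluidPDE

variable {d : Type*} [Fintype d] {X : Type*}

/-! ### The pair increment of a test function -/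

/-- **The full pair increment of a one-particle test function** `φ : X → ℝ^d → ℝ` in an Enskog
collision: particle at `x` with velocity `v`, partner at contact `x + εω` (`G.translate x (ε • ω)`)
with velocity `w`, outgoing velocities `(v′, w′) = collide ω (v, w)`:
`φ(x, v′) + φ(x + εω, w′) − φ(x, v) − φ(x + εω, w)` (the bracket of the symmetrised weak form of the
Enskog operator; for `ε = 0` and `φ` independent of `x` it is the Boltzmann bracket
`φ′ + φ′_* − φ − φ_*`). [cite: Soto2016, §4.8.1 eq. (4.87)] -/
def enskogPairIncrement (G : Geometry d X) (ε : ℝ) (φ : X → EuclideanSpace ℝ d → ℝ) (x : X)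
    (v w : EuclideanSpace ℝ d) (ω : sphere (0 : EuclideanSpace ℝ d) 1) : ℝ :=
  φ x (collide ω (v, w)).1 + φ (G.translate x (ε • (ω : EuclideanSpace ℝ d))) (collide ω (v, w)).2 -
    φ x v - φ (G.translate x (ε • (ω : EuclideanSpace ℝ d))) w

/-- Unfolding lemma for `enskogPairIncrement`. [folklore] -/
theorem enskogPairIncrement_apply (G : Geometry d X) (ε : ℝ) (φ : X → EuclideanSpace ℝ d → ℝ)
    (x : X) (v w : EuclideanSpace ℝ d) (ω : sphere (0 : EuclideanSpace ℝ d) 1) :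
    enskogPairIncrement G ε φ x v w ω =
      φ x (collide ω (v, w)).1 + φ (G.translate x (ε • (ω : EuclideanSpace ℝ d))) (collide ω (v, w)).2 -
        φ x v - φ (G.translate x (ε • (ω : EuclideanSpace ℝ d))) w :=
  rfl

/-- **Collision invariants have zero increment.** If `φ(x, v) = ψ(v)` does not depend on the
position and `ψ` is a collision invariant (`ψ(v′) + ψ(w′) = ψ(v) + ψ(w)`; e.g. `1`, `v`, `|v|²`,
`isCollisionInvariant_quadratic`), the pair increment vanishes identically. [folklore] -/
theorem enskogPairIncrement_eq_zero_of_isCollisionInvariant (G : Geometry d X) (ε : ℝ)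
    {ψ : EuclideanSpace ℝ d → ℝ} (hψ : IsCollisionInvariant ψ) (x : X) (v w : EuclideanSpace ℝ d)
    (ω : sphere (0 : EuclideanSpace ℝ d) 1) :
    enskogPairIncrement G ε (fun _ => ψ) x v w ω = 0 := by
  have h := hψ ω (v, w)
  simp only [enskogPairIncrement]
  linarith

/-- **Exchange symmetry of the increment.** Seen from the partner — position `x + εω`, velocities
exchanged, impact direction reversed — the pair increment is the same:
`Δφ(x + εω, w, v, −ω) = Δφ(x, v, w, ω)` (`collide (−ω) (w, v) = (w′, v′)`, and
`(x + εω) + ε(−ω) = x` by the action axioms of the geometry). [folklore] -/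
theorem enskogPairIncrement_exchange (G : Geometry d X) (ε : ℝ) (φ : X → EuclideanSpace ℝ d → ℝ)
    (x : X) (v w : EuclideanSpace ℝ d) (ω : sphere (0 : EuclideanSpace ℝ d) 1) :
    enskogPairIncrement G ε φ (G.translate x (ε • (ω : EuclideanSpace ℝ d))) w v (-ω) =
      enskogPairIncrement G ε φ x v w ω := by
  have hc : collide (-ω) (w, v) = ((collide ω (v, w)).2, (collide ω (v, w)).1) := by
    rw [collide_neg_dir]
    exact collide_swap ω (v, w)
  have ht : G.translate (G.translate x (ε • (ω : EuclideanSpace ℝ d)))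
      (ε • ((-ω : sphere (0 : EuclideanSpace ℝ d) 1) : EuclideanSpace ℝ d)) = x := by
    rw [coe_neg_sphere, smul_neg, G.translate_add, add_neg_cancel, G.translate_zero]
  simp only [enskogPairIncrement, hc, ht]
  ring

/-- **The increment of the position–momentum coupling is the collisional transfer.** In the
Euclidean geometry, for `φ(x, v) = ⟪x, v⟫` the pair increment is `ε (v − w)·ω`: momentum is
conserved in the collision (`v′ + w′ = v + w`) but is transferred over the contact distance `εω`
(Soto §4.8.2, collisional transfer) — in particular the increment, and the operator, are not
identically zero. [folklore] -/
theorem enskogPairIncrement_inner_euclidean (ε : ℝ) (x v w : EuclideanSpace ℝ d)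
    (ω : sphere (0 : EuclideanSpace ℝ d) 1) :
    enskogPairIncrement (Euclidean.geometry d) ε (fun y u => ⟪y, u⟫_ℝ) x v w ω =
      ε * ⟪v - w, (ω : EuclideanSpace ℝ d)⟫_ℝ := by
  have h1 : ⟪(ω : EuclideanSpace ℝ d), (ω : EuclideanSpace ℝ d)⟫_ℝ = 1 := real_inner_self_sphere ω
  simp only [enskogPairIncrement, collide, Euclidean.geometry_translate, inner_add_left,
    inner_sub_right, inner_add_right, real_inner_smul_left, real_inner_smul_right, h1]
  ring

/-! ### The test-side Enskog operator -/

/-- **The test-side (adjoint) linearised Enskog collision operator** for hard spheres of diameter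
`ε` on a position space `X` with geometry `G` (in use: the torus `𝕋³`), with rate `rate = λ`,
contact weight `Y : X → S^{d-1} → ℝ` (the pair correlation at contact, evaluated wherever the user
chooses, e.g. at the midpoint `x + εω/2`), background one-particle density `g` and test function
`φ`:
`(L φ)(x, v) = λ ∫_{S^{d-1}} ( ∫_{ℝ^d} ((v − w)·ω)₊ · Y(x, ω) · g(x + εω, w) · Δφ(x, v, w, ω) dw ) dσ(ω)`,
`Δφ = enskogPairIncrement` the full pair increment, `((v − w)·ω)₊ = hardSphereKernel`,
`dσ = sphereMeasure`; the partner is drawn from the background at contact distance `ε` in the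
direction `ω` (Enskog's collision operator, Soto (4.87); van Beijeren–Ernst 1973; the symmetrised
form testing it against `φ` is Résibois' 1978).  No integrability is built in (junk value `0` of the
Bochner integral). [cite: Soto2016, §4.8.1 eq. (4.87)] -/
def enskogTestOperator (G : Geometry d X) (ε rate : ℝ)
    (Y : X → sphere (0 : EuclideanSpace ℝ d) 1 → ℝ) (g φ : X → EuclideanSpace ℝ d → ℝ)
    (x : X) (v : EuclideanSpace ℝ d) : ℝ :=
  rate * ∫ ω, (∫ w, hardSphereKernel (v, w) ω * Y x ω *
      g (G.translate x (ε • (ω : EuclideanSpace ℝ d))) w * enskogPairIncrement G ε φ x v w ω)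
    ∂sphereMeasure

/-- Unfolding lemma for `enskogTestOperator`. [folklore] -/
theorem enskogTestOperator_apply (G : Geometry d X) (ε rate : ℝ)
    (Y : X → sphere (0 : EuclideanSpace ℝ d) 1 → ℝ) (g φ : X → EuclideanSpace ℝ d → ℝ)
    (x : X) (v : EuclideanSpace ℝ d) :
    enskogTestOperator G ε rate Y g φ x v =
      rate * ∫ ω, (∫ w, hardSphereKernel (v, w) ω * Y x ω *
        g (G.translate x (ε • (ω : EuclideanSpace ℝ d))) w * enskogPairIncrement G ε φ x v w ω)
        ∂sphereMeasure :=
  rfl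

/-- At rate `0` the operator vanishes. [folklore] -/
@[simp]
theorem enskogTestOperator_zero_rate (G : Geometry d X) (ε : ℝ)
    (Y : X → sphere (0 : EuclideanSpace ℝ d) 1 → ℝ) (g φ : X → EuclideanSpace ℝ d → ℝ) :
    enskogTestOperator G ε 0 Y g φ = 0 := by
  funext x v
  simp [enskogTestOperator]

/-- The operator is linear in the rate: `L_{cλ} = c L_λ`. [folklore] -/
theorem enskogTestOperator_mul_rate (G : Geometry d X) (ε c rate : ℝ)
    (Y : X → sphere (0 : EuclideanSpace ℝ d) 1 → ℝ) (g φ : X → EuclideanSpace ℝ d → ℝ)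
    (x : X) (v : EuclideanSpace ℝ d) :
    enskogTestOperator G ε (c * rate) Y g φ x v = c * enskogTestOperator G ε rate Y g φ x v := by
  simp only [enskogTestOperator, mul_assoc]

/-- **Collision invariants are annihilated.** For a test function `φ(x, v) = ψ(v)` independent of
the position with `ψ` a collision invariant (`1`, the components of `v`, `|v|²`), `L φ = 0`
identically — formal conservation of mass, momentum and energy by the Enskog collision process (for
`x`-dependent `φ` the increment only vanishes up to the `O(ε)` contact shift, the collisional
transfer). [folklore] -/
theorem enskogTestOperator_const_of_isCollisionInvariant (G : Geometry d X) (ε rate : ℝ)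
    (Y : X → sphere (0 : EuclideanSpace ℝ d) 1 → ℝ) (g : X → EuclideanSpace ℝ d → ℝ)
    {ψ : EuclideanSpace ℝ d → ℝ} (hψ : IsCollisionInvariant ψ) :
    enskogTestOperator G ε rate Y g (fun _ => ψ) = 0 := by
  funext x v
  simp [enskogTestOperator, enskogPairIncrement_eq_zero_of_isCollisionInvariant G ε hψ]

end Literature.Analysis.FluidPDE
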